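import Summits.CriticalPhenomena.PercolationContinuityZ3.Theorems.PercNearOneGluingNoHeavyQuantDepthOneGeneralPointwise
import HarnessLib

/-!
# QUANT lane R8, GRADED-CLOSURE programme: G₀ for EVERY PARTNER — part 2, the row theorem (explicit data, summation)

builds on p205010 (kernel theorem, internal audit signed; external expert review pending)

Support file (`--supports stmt-CriticalPhenomena-4575`), QUANT lane seat prim-quant-arm-1 (gen 44, architect seat), rung R8 of
`run/shared/lean/prim/quant/LADDER.md`; memo `run/shared/lean/prim/quant/prim-quant-arm-1-g44/G0-SUBUNIT-G44.md` §7 (Theorem 3).  Part 2 of 2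
(part 1: `…QuantDepthOneGeneralPointwise`, the cell inequality `general_pointwise`).  Theorems only, standard axioms, no sorries.

THE THEOREM (`generalConv_twoLayerRow_of_tlc`, q = 1, ANY floor `0 < y < 1`).  Let `μ₁ ≥ 0` on `{0..M₁}` satisfy the depth-1 family
`LawDec.TLC y T₁ M₁ μ₁`, and `μ₂ ≥ 0`, vanishing above `M₂`, satisfy the two-layer family at target `T₂` (the body of `LawDec.TLB (y/(1−y)) T₂ M₂ μ₂`, written out; any parameter `T₂ > 0`; in the
application the partner's mean: an ARBITRARY partner).  Let `2d < T₁` (the product threshold is a low of the big factor), `j₀ < T₁+T₂−d ≤ j₀+1`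
(`j₀ + 1 = ⌈T−d⌉`), `j₀ < M₁`, `m − 1 ≤ T₁ − d < m` (`m = ⌊T₁−d⌋ + 1`), and suppose the TOP HOLE is heavy: `m ≤ j₀ → usage y T₁ j₀ d j₀ ≥ 1` — automatic in the
DEEP regime `T₁ − 2d ≥ T₂` (`general_hole_heavy_of_deep`).  Then the two-layer row `d` of `lconv M₁ M₂ μ₁ μ₂` holds at target `T₁ + T₂`:
`u·Σ_{h ≤ d} (μ₁∗μ₂) h ≤ Σ_{h ≥ T₁+T₂−d} (μ₁∗μ₂) h`.  No mass, mean or top-affordability hypothesis on either factor.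

THE DATA (memo §7): holes `h ∈ [m, j₀]`; `B h = min(h − m, j₀ − h)` (the columns in which `h` is a compatible mid are `b ≤ B h`; `2·B h < T₂`);
`κ h = 1/usage y T₁ j₀ d h` on holes, `0` elsewhere (`κ` is increasing along the holes, `usage_anti_mid`, and `≤ 1` by the heaviness of the top hole; it pays
every hole cell because `usage` is antitone in the low, `usage_anti_low`, and independent of the layer below it); `c b = ⌈T₂ − b⌉₊`, mixing layer
`hs b = j₀ − c b`, mixing weight `w b = κ (j₀ − c b)` when `m + 2·c b ≤ j₀` (some hole's partner row is negative at `b`) and `0` otherwise.  The eight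
relations of part 1 are verified from these closed forms, and the certificate is summed against `μ₁ ⊗ μ₂` (the test-function identity for `lconv`).
Special cases: `…QuantDepthOneSubUnitRow` (✓ p383717, `T₂ ≤ 1`), `…QuantDepthOneSubTwoRow` (p384084, `T₂ ≤ 2`); with the mirror statement
(`lconv_comm`) this covers every product two-layer row below `max(T₁,T₂)/2` with a heavy top hole — what remains of G₀ at `q = 1` is the top band
`max(T₁,T₂) ≤ 2d < T₁+T₂` and the light-top-hole rows (memo §6–§7).
EVIDENCE: the closed-form certificate verified in exact arithmetic on 224 316 cells (every partner `M₂ ≤ 15`, any `T₂`, ten floors, `M₁ ≤ 24`, every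
row with `2d < T₁` and a heavy top hole): 0 failures (`quant/prim-quant-arm-1-g44/code/cert_g.py`).  HONEST STATUS: a support theorem for the OPEN node
G₀ (`LawDec.TLCGateConvTLB`); RATE class log\* / honest sentence of `run/shared/lean/prim/quant/README.md` unchanged.

[this work]; relay case / depth-1 rows: prim-quant-census-2 g63/g64; tensor principle: prim-quant-arm-2 g38; `usage_anti_low/mid`: this lane.  Nothing here
is cited as a published result.  The gluing rows served [cite: KozmaNitzan2024, Conjecture 3 (p. 15)]; product measure [cite: Grimmett1999, §1.3 p. 10].
-/

noncomputable section

namespace Summit.CriticalPhenomena.PercolationContinuityZ3.Theorems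

namespace Quant

open Finset

namespace LawDec

/-- in the deep regime the top hole is heavy: `T₁ − 2d ≥ T₂`, `T₁ − d < j₀ < T₁ + T₂ − d` ⟹ `usage y T₁ j₀ d j₀ ≥ 1`. [this work] -/
theorem general_hole_heavy_of_deep (y T₁ T₂ : ℝ) (d j₀ : ℕ) (hy0 : 0 < y) (hy1 : y < 1)
    (hlow : 2 * (d : ℝ) < T₁) (hj0 : (j₀ : ℝ) < T₁ + T₂ - d) (hs : T₂ ≤ T₁ - 2 * (d : ℝ)) (hhole : T₁ - d < (j₀ : ℝ)) :
    1 ≤ usage y T₁ j₀ d j₀ := by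
  have hcomp : T₁ < (d : ℝ) + j₀ := by linarith
  refine le_trans ?_ (heavy_le_usage y T₁ j₀ d j₀ hy0 hy1 le_rfl hlow hcomp)
  rw [le_div_iff₀ (by linarith)]
  linarith

/-- **G₀ FOR EVERY PARTNER (q = 1, any floor).**  See the file header. [this work] -/
theorem generalConv_twoLayerRow_of_tlc (y T₁ T₂ : ℝ) (M₁ M₂ d j₀ m : ℕ) (μ₁ μ₂ : ℕ → ℝ)
    (hy0 : 0 < y) (hy1 : y < 1) (h10 : ∀ a, 0 ≤ μ₁ a) (h20 : ∀ b, 0 ≤ μ₂ b) (h2M : ∀ b, M₂ < b → μ₂ b = 0)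
    (hT20 : 0 < T₂) (hlow : 2 * (d : ℝ) < T₁)
    (hj0 : (j₀ : ℝ) < T₁ + T₂ - d) (hj0' : T₁ + T₂ - d ≤ (j₀ : ℝ) + 1) (hj0M : j₀ < M₁)
    (hm : (m : ℝ) - 1 ≤ T₁ - d) (hm' : T₁ - d < (m : ℝ))
    (hTLC : TLC y T₁ M₁ μ₁)
    (hTLB2 : ∀ i : ℕ, 2 * (i : ℝ) < T₂ → y / (1 - y) * ∑ b ∈ Finset.range (i + 1), μ₂ b
      ≤ ∑ b ∈ Finset.range (M₂ + 1), (if T₂ - i ≤ (b : ℝ) then μ₂ b else 0))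
    (hheavy : m ≤ j₀ → 1 ≤ usage y T₁ j₀ d j₀) :
    y / (1 - y) * ∑ h ∈ Finset.range (d + 1), lconv M₁ M₂ μ₁ μ₂ h
      ≤ ∑ h ∈ Finset.range (M₁ + M₂ + 1), (if T₁ + T₂ - d ≤ (h : ℝ) then lconv M₁ M₂ μ₁ μ₂ h else 0) := by
  classical
  have h1y : 0 < 1 - y := by linarith
  have hu0 : 0 < y / (1 - y) := div_pos hy0 h1y
  have hdj : d ≤ j₀ := by
    have : (d : ℝ) < j₀ + 1 := by linarith
    have : d < j₀ + 1 := by exact_mod_cast this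
    omega
  have hdM : d + 1 ≤ M₁ + M₂ + 1 := by omega
  have hj0m : (j₀ : ℝ) < m + T₂ := by linarith
  have hmd : d < m := by
    have : (d : ℝ) < m := by linarith
    exact_mod_cast this
  ---------------------------------------------------------------- the data
  let B : ℕ → ℕ := fun h => min (h - m) (j₀ - h)
  let κ : ℕ → ℝ := fun h => if m ≤ h ∧ h ≤ j₀ then 1 / usage y T₁ j₀ d h else 0
  let c : ℕ → ℕ := fun b => ⌈T₂ - (b : ℝ)⌉₊
  let hs : ℕ → ℕ := fun b => j₀ - c b
  let w : ℕ → ℝ := fun b => if m + 2 * c b ≤ j₀ then κ (j₀ - c b) else 0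
  ---------------------------------------------------------------- usage facts on holes
  have hupos : ∀ h, m ≤ h → 0 < usage y T₁ j₀ d h := by
    intro h hmh
    have hmr : (m : ℝ) ≤ h := by exact_mod_cast hmh
    exact usage_pos_of_compat y T₁ j₀ d h hy0 hy1 hlow (by omega) (Or.inr (by linarith))
  have hmono : ∀ h h', m ≤ h → h ≤ h' → h' ≤ j₀ → usage y T₁ j₀ d h' ≤ usage y T₁ j₀ d h := by
    intro h h' hmh hhh hhj
    rcases Nat.eq_or_lt_of_le hhh with he | hlt
    · rw [he]
    · have hmr : (m : ℝ) ≤ h := by exact_mod_cast hmh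
      exact usage_anti_mid y T₁ j₀ d h h' hy0 hy1 hlt hhj hlow (by linarith)
  have hκv : ∀ h, m ≤ h → h ≤ j₀ → κ h = 1 / usage y T₁ j₀ d h := fun h h1 h2 => by
    show (if m ≤ h ∧ h ≤ j₀ then 1 / usage y T₁ j₀ d h else 0) = _; rw [if_pos ⟨h1, h2⟩]
  have hκ0 : ∀ h, 0 ≤ κ h := by
    intro h; show 0 ≤ (if m ≤ h ∧ h ≤ j₀ then 1 / usage y T₁ j₀ d h else 0)
    split_ifs with hh
    · exact div_nonneg zero_le_one (hupos h hh.1).le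
    · exact le_rfl
  have hκ1 : ∀ h, κ h ≤ 1 := by
    intro h; show (if m ≤ h ∧ h ≤ j₀ then 1 / usage y T₁ j₀ d h else 0) ≤ 1
    split_ifs with hh
    · have htop := hheavy (le_trans hh.1 hh.2)
      have := hmono h j₀ hh.1 hh.2 le_rfl
      rw [div_le_one (hupos h hh.1)]; linarith
    · exact zero_le_one
  have hκout : ∀ h, ¬ (m ≤ h ∧ h ≤ j₀) → κ h = 0 := fun h hh => by
    show (if m ≤ h ∧ h ≤ j₀ then 1 / usage y T₁ j₀ d h else 0) = 0; rw [if_neg hh]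
  have hκmono : ∀ h h', m ≤ h → h ≤ h' → h' ≤ j₀ → κ h ≤ κ h' := by
    intro h h' h1 h2 h3
    rw [hκv h h1 (le_trans h2 h3), hκv h' (le_trans h1 h2) h3]
    exact one_div_le_one_div_of_le (hupos h' (le_trans h1 h2)) (hmono h h' h1 h2 h3)
  have hκhole : ∀ (h b' : ℕ), m ≤ h → h ≤ j₀ → b' ≤ B h → b' ≤ d → 1 / usage y T₁ (j₀ - b') (d - b') h ≤ κ h := by
    intro h b' h1 h2 hb hbd
    rw [hκv h h1 h2]
    have hBle : B h ≤ h - m ∧ B h ≤ j₀ - h := ⟨Nat.min_le_left _ _, Nat.min_le_right _ _⟩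
    have hhj : h ≤ j₀ - b' := by omega
    -- layer independence below the layer
    have hlay : usage y T₁ (j₀ - b') (d - b') h = usage y T₁ j₀ (d - b') h := by
      unfold usage gateOf; rw [if_neg (by omega), if_neg (by omega)]
    rw [hlay]
    refine one_div_le_one_div_of_le (hupos h h1) ?_
    rcases Nat.eq_zero_or_pos b' with hb0 | hbp
    · subst hb0; simp
    · have hmr : (m : ℝ) ≤ h := by exact_mod_cast h1
      have hcast : ((d - b' : ℕ) : ℝ) = (d : ℝ) - b' := by rw [Nat.cast_sub hbd]
      have hmb : ((m + b' : ℕ) : ℝ) ≤ h := by exact_mod_cast (show m + b' ≤ h by omega)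
      push_cast at hmb
      have h2h : T₁ ≤ 2 * (h : ℝ) := by linarith
      exact usage_anti_low y T₁ j₀ (d - b') d h hy0 hy1 (by omega) hlow (by rw [hcast]; linarith) (Or.inr h2h)
  have hB : ∀ (h : ℕ), m ≤ h → h ≤ j₀ → m + B h ≤ h ∧ h + B h ≤ j₀ := by
    intro h h1 h2
    have : B h ≤ h - m ∧ B h ≤ j₀ - h := ⟨Nat.min_le_left _ _, Nat.min_le_right _ _⟩
    omega
  have hBmax : ∀ (h b' : ℕ), b' ≤ d → m + b' ≤ h → h + b' ≤ j₀ → b' ≤ B h := by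
    intro h b' _ h1 h2; exact le_min (by omega) (by omega)
  have hB2 : ∀ h, m ≤ h → h ≤ j₀ → 2 * ((B h : ℕ) : ℝ) < T₂ := by
    intro h h1 h2
    obtain ⟨a1, a2⟩ := hB h h1 h2
    have : m + 2 * B h ≤ j₀ := by omega
    have : ((m + 2 * B h : ℕ) : ℝ) ≤ j₀ := by exact_mod_cast this
    push_cast at this; linarith
  have hw0 : ∀ b', 0 ≤ w b' := by
    intro b'; show 0 ≤ (if m + 2 * c b' ≤ j₀ then κ (j₀ - c b') else 0)
    split_ifs; exacts [hκ0 _, le_rfl]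
  have hw1 : ∀ b', w b' ≤ 1 := by
    intro b'; show (if m + 2 * c b' ≤ j₀ then κ (j₀ - c b') else 0) ≤ 1
    split_ifs; exacts [hκ1 _, zero_le_one]
  have hmix : ∀ (b' h : ℕ), m ≤ h → h ≤ j₀ → T₂ - (B h : ℝ) ≤ (b' : ℝ) → h ≤ hs b' ∧ κ h ≤ w b' := by
    intro b' h h1 h2 hb
    have hcB : c b' ≤ B h := Nat.ceil_le.2 (by linarith)
    obtain ⟨a1, a2⟩ := hB h h1 h2
    have hact : m + 2 * c b' ≤ j₀ := by omega
    have hhs' : h ≤ j₀ - c b' := by omega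
    refine ⟨hhs', ?_⟩
    show κ h ≤ (if m + 2 * c b' ≤ j₀ then κ (j₀ - c b') else 0)
    rw [if_pos hact]
    exact hκmono h (j₀ - c b') h1 hhs' (Nat.sub_le _ _)
  have hhs : ∀ (b' : ℕ), 0 < w b' → j₀ ≤ hs b' + b' ∧ hs b' ≤ j₀ ∧ ((hs b' : ℕ) : ℝ) ≤ T₁ - d + b' := by
    intro b' hwb
    have hact : m + 2 * c b' ≤ j₀ := by
      by_contra hn
      have : w b' = 0 := by show (if m + 2 * c b' ≤ j₀ then κ (j₀ - c b') else 0) = 0; rw [if_neg hn]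
      linarith
    have hcle : T₂ - (b' : ℝ) ≤ (c b' : ℕ) := Nat.le_ceil _
    have hc2 : ((m + 2 * c b' : ℕ) : ℝ) ≤ j₀ := by exact_mod_cast hact
    push_cast at hc2
    have hcb : (c b' : ℝ) < b' := by linarith
    have hcb' : c b' ≤ b' := by exact_mod_cast hcb.le
    have hcast : ((j₀ - c b' : ℕ) : ℝ) = (j₀ : ℝ) - (c b' : ℕ) := by rw [Nat.cast_sub (by omega)]
    refine ⟨by show j₀ ≤ j₀ - c b' + b'; omega, Nat.sub_le _ _, ?_⟩
    show ((j₀ - c b' : ℕ) : ℝ) ≤ T₁ - d + b'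
    rw [hcast]; linarith
  ---------------------------------------------------------------- functional forms of the hypotheses
  have htf : ∀ (j i : ℕ), j < M₁ → i ≤ j → 2 * (i : ℝ) < T₁ →
      ∑ a ∈ Finset.range (M₁ + 1), μ₁ a * (y / (1 - y) * (if a ≤ i then (1 : ℝ) else 0) - (if j + 1 ≤ a then (1 : ℝ) else 0)
        - y / (1 - y) * (if a ≤ j ∧ T₁ < ((i : ℕ) : ℝ) + a then 1 / usage y T₁ j i a else 0)) ≤ 0 := by
    intro j i hjM hij hlow'
    have hrow := hTLC j i hjM hij hlow'
    have hiM : i + 1 ≤ M₁ + 1 := by omega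
    have hlowsum : ∑ l ∈ Finset.range (i + 1), μ₁ l = ∑ a ∈ Finset.range (M₁ + 1), (if a ≤ i then μ₁ a else 0) := by
      rw [← Finset.sum_range_add_sum_Ico _ hiM]
      have h1 : ∑ a ∈ Finset.range (i + 1), (if a ≤ i then μ₁ a else 0) = ∑ l ∈ Finset.range (i + 1), μ₁ l :=
        Finset.sum_congr rfl fun a ha => by rw [if_pos (by rw [Finset.mem_range] at ha; omega)]
      have h2 : ∑ a ∈ Finset.Ico (i + 1) (M₁ + 1), (if a ≤ i then μ₁ a else 0) = 0 :=
        Finset.sum_eq_zero fun a ha => by rw [Finset.mem_Ico] at ha; rw [if_neg (by omega)]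
      rw [h1, h2, add_zero]
    rw [hlowsum] at hrow
    have e : ∀ a ∈ Finset.range (M₁ + 1), μ₁ a * (y / (1 - y) * (if a ≤ i then (1 : ℝ) else 0) - (if j + 1 ≤ a then (1 : ℝ) else 0)
        - y / (1 - y) * (if a ≤ j ∧ T₁ < ((i : ℕ) : ℝ) + a then 1 / usage y T₁ j i a else 0))
        = y / (1 - y) * (if a ≤ i then μ₁ a else 0) - (if j + 1 ≤ a then μ₁ a else 0)
          - y / (1 - y) * (if a ≤ j ∧ T₁ < ((i : ℕ) : ℝ) + a then μ₁ a / usage y T₁ j i a else 0) := by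
      intro a _; split_ifs <;> ring
    rw [Finset.sum_congr rfl e, Finset.sum_sub_distrib, Finset.sum_sub_distrib, ← Finset.mul_sum, ← Finset.mul_sum]
    linarith
  have hpartner : ∀ (i : ℕ), 2 * (i : ℝ) < T₂ →
      ∑ b ∈ Finset.range (M₂ + 1), (y / (1 - y) * (if b ≤ i then (1 : ℝ) else 0) - (if T₂ - (i : ℝ) ≤ (b : ℝ) then (1 : ℝ) else 0)) * μ₂ b ≤ 0 := by
    intro i hi
    have hrow := hTLB2 i hi
    have hlowsum : ∑ b ∈ Finset.range (i + 1), μ₂ b = ∑ b ∈ Finset.range (M₂ + 1), (if b ≤ i then μ₂ b else 0) := by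
      rcases Nat.lt_or_ge M₂ i with hgt | hle
      · rw [← Finset.sum_range_add_sum_Ico _ (show M₂ + 1 ≤ i + 1 by omega)]
        have h1 : ∑ b ∈ Finset.range (M₂ + 1), (if b ≤ i then μ₂ b else 0) = ∑ b ∈ Finset.range (M₂ + 1), μ₂ b :=
          Finset.sum_congr rfl fun a ha => by rw [if_pos (by rw [Finset.mem_range] at ha; omega)]
        have h2 : ∑ b ∈ Finset.Ico (M₂ + 1) (i + 1), μ₂ b = 0 :=
          Finset.sum_eq_zero fun a ha => by rw [Finset.mem_Ico] at ha; exact h2M a (by omega)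
        rw [h1, h2, add_zero]
      · rw [← Finset.sum_range_add_sum_Ico _ (show i + 1 ≤ M₂ + 1 by omega)]
        have h1 : ∑ a ∈ Finset.range (i + 1), (if a ≤ i then μ₂ a else 0) = ∑ l ∈ Finset.range (i + 1), μ₂ l :=
          Finset.sum_congr rfl fun a ha => by rw [if_pos (by rw [Finset.mem_range] at ha; omega)]
        have h2 : ∑ a ∈ Finset.Ico (i + 1) (M₂ + 1), (if a ≤ i then μ₂ a else 0) = 0 :=
          Finset.sum_eq_zero fun a ha => by rw [Finset.mem_Ico] at ha; rw [if_neg (by omega)]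
        rw [h1, h2, add_zero]
    rw [hlowsum] at hrow
    have e : ∀ b ∈ Finset.range (M₂ + 1),
        (y / (1 - y) * (if b ≤ i then (1 : ℝ) else 0) - (if T₂ - (i : ℝ) ≤ (b : ℝ) then (1 : ℝ) else 0)) * μ₂ b
        = y / (1 - y) * (if b ≤ i then μ₂ b else 0) - (if T₂ - (i : ℝ) ≤ (b : ℝ) then μ₂ b else 0) := by
      intro b _; split_ifs <;> ring
    rw [Finset.sum_congr rfl e, Finset.sum_sub_distrib, ← Finset.mul_sum]
    linarith
  ---------------------------------------------------------------- the test function against the convolution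
  have hconv : ∀ φ : ℕ → ℝ, ∑ h ∈ Finset.range (M₁ + M₂ + 1), φ h * lconv M₁ M₂ μ₁ μ₂ h
      = ∑ a ∈ Finset.range (M₁ + 1), ∑ s ∈ Finset.range (M₂ + 1), φ (a + s) * (μ₁ a * μ₂ s) := by
    intro φ
    simp only [lconv, Finset.mul_sum]; rw [Finset.sum_comm]
    refine Finset.sum_congr rfl fun a ha => ?_
    rw [Finset.sum_comm]
    refine Finset.sum_congr rfl fun s hs' => ?_
    rw [Finset.mem_range] at ha hs'
    have e : ∀ h : ℕ, φ h * (if a + s = h then μ₁ a * μ₂ s else 0) = if a + s = h then φ (a + s) * (μ₁ a * μ₂ s) else 0 := by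
      intro h; split_ifs with hh; · rw [hh]
      rw [mul_zero]
    simp_rw [e]
    rw [Finset.sum_ite_eq (Finset.range (M₁ + M₂ + 1)) (a + s), if_pos (Finset.mem_range.2 (by omega))]
  set ν := lconv M₁ M₂ μ₁ μ₂ with hν
  have hL : ∑ h ∈ Finset.range (d + 1), ν h = ∑ h ∈ Finset.range (M₁ + M₂ + 1), (if h ≤ d then (1 : ℝ) else 0) * ν h := by
    rw [← Finset.sum_range_add_sum_Ico _ hdM]
    have e1 : ∑ h ∈ Finset.range (d + 1), (if h ≤ d then (1 : ℝ) else 0) * ν h = ∑ h ∈ Finset.range (d + 1), ν h :=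
      Finset.sum_congr rfl fun h hh => by rw [if_pos (by rw [Finset.mem_range] at hh; omega), one_mul]
    have e2 : ∑ h ∈ Finset.Ico (d + 1) (M₁ + M₂ + 1), (if h ≤ d then (1 : ℝ) else 0) * ν h = 0 :=
      Finset.sum_eq_zero fun h hh => by rw [Finset.mem_Ico] at hh; rw [if_neg (by omega), zero_mul]
    rw [e1, e2, add_zero]
  have hR : ∑ h ∈ Finset.range (M₁ + M₂ + 1), (if T₁ + T₂ - d ≤ (h : ℝ) then ν h else 0)
      = ∑ h ∈ Finset.range (M₁ + M₂ + 1), (if T₁ + T₂ - d ≤ (h : ℝ) then (1 : ℝ) else 0) * ν h :=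
    Finset.sum_congr rfl fun h _ => by split_ifs <;> simp
  rw [hL, hR, Finset.mul_sum]
  have hK : ∑ h ∈ Finset.range (M₁ + M₂ + 1), y / (1 - y) * ((if h ≤ d then (1 : ℝ) else 0) * ν h)
        - ∑ h ∈ Finset.range (M₁ + M₂ + 1), (if T₁ + T₂ - d ≤ (h : ℝ) then (1 : ℝ) else 0) * ν h
      = ∑ h ∈ Finset.range (M₁ + M₂ + 1),
          (y / (1 - y) * (if h ≤ d then (1 : ℝ) else 0) - (if T₁ + T₂ - d ≤ (h : ℝ) then (1 : ℝ) else 0)) * ν h := by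
    rw [← Finset.sum_sub_distrib]
    exact Finset.sum_congr rfl fun h _ => by ring
  rw [← sub_nonpos, hK, hν, hconv]
  ---------------------------------------------------------------- cells
  have hcell : ∀ a ∈ Finset.range (M₁ + 1), ∀ b ∈ Finset.range (M₂ + 1),
      (y / (1 - y) * (if a + b ≤ d then (1 : ℝ) else 0) - (if T₁ + T₂ - d ≤ ((a + b : ℕ) : ℝ) then (1 : ℝ) else 0)) * (μ₁ a * μ₂ b)
        ≤ μ₂ b * ((if b ≤ d then (1 - w b) * (y / (1 - y) * (if a ≤ (d - b) then (1 : ℝ) else 0) - (if (j₀ - b) + 1 ≤ a then (1 : ℝ) else 0) - y / (1 - y) * (if a ≤ (j₀ - b) ∧ T₁ < ((d - b : ℕ) : ℝ) + a then 1 / usage y T₁ (j₀ - b) (d - b) a else 0)) + w b * (y / (1 - y) * (if a ≤ (d - b) then (1 : ℝ) else 0) - (if (hs b) + 1 ≤ a then (1 : ℝ) else 0) - y / (1 - y) * (if a ≤ (hs b) ∧ T₁ < ((d - b : ℕ) : ℝ) + a then 1 / usage y T₁ (hs b) (d - b) a else 0)) else 0) * μ₁ a)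
          + (κ a * μ₁ a) * ((y / (1 - y) * (if b ≤ B a then (1 : ℝ) else 0) - (if T₂ - (B a : ℝ) ≤ (b : ℝ) then (1 : ℝ) else 0)) * μ₂ b) := by
    intro a _ b _
    have hp := general_pointwise y T₁ T₂ d j₀ m κ w B hs a b hy0 hy1 hT20 hlow hj0 hj0' hm hm' hκ0 hκ1 hκout hκhole hB hBmax
      hw0 hmix hhs
    have hwt : 0 ≤ μ₁ a * μ₂ b := mul_nonneg (h10 a) (h20 b)
    have := mul_le_mul_of_nonneg_right hp hwt
    have e : ((if b ≤ d then (1 - w b) * (y / (1 - y) * (if a ≤ (d - b) then (1 : ℝ) else 0) - (if (j₀ - b) + 1 ≤ a then (1 : ℝ) else 0) - y / (1 - y) * (if a ≤ (j₀ - b) ∧ T₁ < ((d - b : ℕ) : ℝ) + a then 1 / usage y T₁ (j₀ - b) (d - b) a else 0)) + w b * (y / (1 - y) * (if a ≤ (d - b) then (1 : ℝ) else 0) - (if (hs b) + 1 ≤ a then (1 : ℝ) else 0) - y / (1 - y) * (if a ≤ (hs b) ∧ T₁ < ((d - b : ℕ) : ℝ) + a then 1 / usage y T₁ (hs b) (d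 - b) a else 0)) else 0) + κ a * (y / (1 - y) * (if b ≤ B a then (1 : ℝ) else 0) - (if T₂ - (B a : ℝ) ≤ (b : ℝ) then (1 : ℝ) else 0))) * (μ₁ a * μ₂ b)
        = μ₂ b * ((if b ≤ d then (1 - w b) * (y / (1 - y) * (if a ≤ (d - b) then (1 : ℝ) else 0) - (if (j₀ - b) + 1 ≤ a then (1 : ℝ) else 0) - y / (1 - y) * (if a ≤ (j₀ - b) ∧ T₁ < ((d - b : ℕ) : ℝ) + a then 1 / usage y T₁ (j₀ - b) (d - b) a else 0)) + w b * (y / (1 - y) * (if a ≤ (d - b) then (1 : ℝ) else 0) - (if (hs b) + 1 ≤ a then (1 : ℝ) else 0) - y / (1 - y) * (if a ≤ (hs b) ∧ T₁ < ((d - b : ℕ) : ℝ) + a then 1 / usage y T₁ (hs b) (d - b) a else 0)) else 0) * μ₁ a)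
          + (κ a * μ₁ a) * ((y / (1 - y) * (if b ≤ B a then (1 : ℝ) else 0) - (if T₂ - (B a : ℝ) ≤ (b : ℝ) then (1 : ℝ) else 0)) * μ₂ b) := by ring
    linarith [this, e]
  refine le_trans (Finset.sum_le_sum fun a ha => Finset.sum_le_sum fun b hb => hcell a ha b hb) ?_
  rw [show (∑ a ∈ Finset.range (M₁ + 1), ∑ b ∈ Finset.range (M₂ + 1),
      (μ₂ b * ((if b ≤ d then (1 - w b) * (y / (1 - y) * (if a ≤ (d - b) then (1 : ℝ) else 0) - (if (j₀ - b) + 1 ≤ a then (1 : ℝ) else 0) - y / (1 - y) * (if a ≤ (j₀ - b) ∧ T₁ < ((d - b : ℕ) : ℝ) + a then 1 / usage y T₁ (j₀ - b) (d - b) a else 0)) + w b * (y / (1 - y) * (if a ≤ (d - b) then (1 : ℝ) else 0) - (if (hs b) + 1 ≤ a then (1 : ℝ) else 0) - y / (1 - y) * (if a ≤ (hs b) ∧ T₁ < ((d - b : ℕ) : ℝ) + a then 1 / usage y T₁ (hs b) (d - b) a else 0)) else 0) * μ₁ a)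
        + (κ a * μ₁ a) * ((y / (1 - y) * (if b ≤ B a then (1 : ℝ) else 0) - (if T₂ - (B a : ℝ) ≤ (b : ℝ) then (1 : ℝ) else 0)) * μ₂ b)))
    = (∑ b ∈ Finset.range (M₂ + 1), μ₂ b * (if b ≤ d then
          (1 - w b) * ∑ a ∈ Finset.range (M₁ + 1), μ₁ a * (y / (1 - y) * (if a ≤ (d - b) then (1 : ℝ) else 0) - (if (j₀ - b) + 1 ≤ a then (1 : ℝ) else 0) - y / (1 - y) * (if a ≤ (j₀ - b) ∧ T₁ < ((d - b : ℕ) : ℝ) + a then 1 / usage y T₁ (j₀ - b) (d - b) a else 0))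
            + w b * ∑ a ∈ Finset.range (M₁ + 1), μ₁ a * (y / (1 - y) * (if a ≤ (d - b) then (1 : ℝ) else 0) - (if (hs b) + 1 ≤ a then (1 : ℝ) else 0) - y / (1 - y) * (if a ≤ (hs b) ∧ T₁ < ((d - b : ℕ) : ℝ) + a then 1 / usage y T₁ (hs b) (d - b) a else 0)) else 0))
      + ∑ a ∈ Finset.range (M₁ + 1), (κ a * μ₁ a) * ∑ b ∈ Finset.range (M₂ + 1), (y / (1 - y) * (if b ≤ B a then (1 : ℝ) else 0) - (if T₂ - (B a : ℝ) ≤ (b : ℝ) then (1 : ℝ) else 0)) * μ₂ b from ?_]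
  · have hH : ∑ b ∈ Finset.range (M₂ + 1), μ₂ b * (if b ≤ d then
          (1 - w b) * ∑ a ∈ Finset.range (M₁ + 1), μ₁ a * (y / (1 - y) * (if a ≤ (d - b) then (1 : ℝ) else 0) - (if (j₀ - b) + 1 ≤ a then (1 : ℝ) else 0) - y / (1 - y) * (if a ≤ (j₀ - b) ∧ T₁ < ((d - b : ℕ) : ℝ) + a then 1 / usage y T₁ (j₀ - b) (d - b) a else 0))
            + w b * ∑ a ∈ Finset.range (M₁ + 1), μ₁ a * (y / (1 - y) * (if a ≤ (d - b) then (1 : ℝ) else 0) - (if (hs b) + 1 ≤ a then (1 : ℝ) else 0) - y / (1 - y) * (if a ≤ (hs b) ∧ T₁ < ((d - b : ℕ) : ℝ) + a then 1 / usage y T₁ (hs b) (d - b) a else 0)) else 0) ≤ 0 := by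
      refine Finset.sum_nonpos fun b _ => ?_
      split_ifs with hbd
      · have hcast : ((d - b : ℕ) : ℝ) = (d : ℝ) - b := by rw [Nat.cast_sub hbd]
        have hb0 : (0 : ℝ) ≤ b := Nat.cast_nonneg b
        have hlow' : 2 * ((d - b : ℕ) : ℝ) < T₁ := by rw [hcast]; linarith
        have h1 := htf (j₀ - b) (d - b) (by omega) (by omega) hlow'
        have h2 : w b * ∑ a ∈ Finset.range (M₁ + 1), μ₁ a * (y / (1 - y) * (if a ≤ (d - b) then (1 : ℝ) else 0) - (if (hs b) + 1 ≤ a then (1 : ℝ) else 0) - y / (1 - y) * (if a ≤ (hs b) ∧ T₁ < ((d - b : ℕ) : ℝ) + a then 1 / usage y T₁ (hs b) (d - b) a else 0)) ≤ 0 := by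
          rcases eq_or_lt_of_le (hw0 b) with hz | hpos
          · rw [← hz, zero_mul]
          · obtain ⟨hs1, hs2, _⟩ := hhs b hpos
            exact mul_nonpos_of_nonneg_of_nonpos (hw0 b) (htf (hs b) (d - b) (by omega) (by omega) hlow')
        have hk' : 0 ≤ 1 - w b := by linarith [hw1 b]
        exact mul_nonpos_of_nonneg_of_nonpos (h20 b) (by nlinarith)
      · rw [mul_zero]
    have hPsum : ∑ a ∈ Finset.range (M₁ + 1), (κ a * μ₁ a) * ∑ b ∈ Finset.range (M₂ + 1), (y / (1 - y) * (if b ≤ B a then (1 : ℝ) else 0) - (if T₂ - (B a : ℝ) ≤ (b : ℝ) then (1 : ℝ) else 0)) * μ₂ b ≤ 0 := by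
      refine Finset.sum_nonpos fun a _ => ?_
      by_cases hh : m ≤ a ∧ a ≤ j₀
      · exact mul_nonpos_of_nonneg_of_nonpos (mul_nonneg (hκ0 a) (h10 a)) (hpartner (B a) (hB2 a hh.1 hh.2))
      · rw [hκout a hh, zero_mul, zero_mul]
    linarith
  · simp_rw [Finset.sum_add_distrib]
    congr 1
    · rw [Finset.sum_comm]
      refine Finset.sum_congr rfl fun b _ => ?_
      by_cases hP : b ≤ d
      · simp only [if_pos hP]
        rw [mul_add, Finset.mul_sum, Finset.mul_sum, Finset.mul_sum, Finset.mul_sum, ← Finset.sum_add_distrib]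
        exact Finset.sum_congr rfl fun a _ => by ring
      · simp only [if_neg hP]
        rw [mul_zero]
        exact Finset.sum_eq_zero fun a _ => by ring
    · refine Finset.sum_congr rfl fun a _ => ?_
      rw [Finset.mul_sum]

end LawDec

end Quant

end Summit.CriticalPhenomena.PercolationContinuityZ3.Theorems
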